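import Summits.Ventures.PercRepro.ProfilePointedCircuitClassesStarSharpP
import Summits.Ventures.PercRepro.ProfilePointedCircuitClassesTwelveSeriesD

/-!
# PercRepro — THE DEFECT FORM OF (★)₉ ON THE SIMPLE COSIMPLE CORE, PART A: EVERY `e`-DEFECT HAS A `C`-PAIR
(p5, gen 57; `proofs/P5-GM1.md` §85 ADD 2)

On a simple cosimple matroid `N` with `#E = 9`, `ρ(E) = 5` and `e ≠ f`, write `X := E − e − f` (seven points).  Every
bi-independent `4`-set through `e` avoiding `f` is `τ + e` for a triple `τ ⊆ X`, every set through `e, f` is `π + e + f` for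
a pair `π ⊆ X`, and (★)₉ at `(e, f)` reads `|D_e| ≤ |D_f| + |C|` with `D_e := {τ : τ + e ∈ BI, τ + f ∉ BI}` (the
`e`-DEFECTS), `D_f` symmetric and `C := {π : π + e + f ∈ BI}` (the `C`-PAIRS).  Parts A and B prove the first structural
fact of the census (§85 ADD 2): **every `e`-defect `τ` contains a `C`-pair** (`cpair_of_defect`, part B).  With
`K := X − τ` (an independent `4`-set whose span `H = cl K` is a hyperplane avoiding `f`), the defect is of TYPE 1
(`f ∈ cl τ`) or of TYPE 2 (`e ∈ H`); in either case some `z ∈ τ − H` has `π := τ − z` with `π + e + f` independent, and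
`X − π = K + z` is a basis because `z ∉ H` (`cpair_of_witness`).  This part holds the rank lemmas: the two-candidate
lemmas of both types (`type_one_two_candidates`, `type_two_two_candidates`) and the rank of `π + e + f`.
-/

open scoped Matroid

namespace PercRepro.Cogirth

open Finset ThmH Skew Shadow Profile

open Classical

variable {α : Type} [DecidableEq α] {N : Matroid α} [N.Finite]

section StarNineDefectA

/-- `ρ(S + z) = ρ(S)` when `z ∈ cl S`. -/
theorem rk_insert_of_mem_clF' {z : α} (hz : z ∈ gr N) {S : Finset α} (hS : S ⊆ gr N) (h : z ∈ clF N S) :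
    rk N (insert z S) = rk N S := by
  rw [rk_insert_eq hz hS, if_pos h]

/-- `ρ(S + z) = ρ(S) + 1` when `z ∉ cl S`. -/
theorem rk_insert_of_notMem_clF' {z : α} (hz : z ∈ gr N) {S : Finset α} (hS : S ⊆ gr N) (h : z ∉ clF N S) :
    rk N (insert z S) = rk N S + 1 := by
  rw [rk_insert_eq hz hS, if_neg h]

/-- A point of `cl {p, q}` with `p, q ∈ cl S` lies in `cl S`. -/
theorem mem_clF_of_mem_clF_pair' {p q x : α} {S : Finset α} (hS : S ⊆ gr N) (hp : p ∈ clF N S) (hq : q ∈ clF N S)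
    (hx : x ∈ clF N ({p, q} : Finset α)) : x ∈ clF N S :=
  clF_subset_clF_of_subset_clF hS (insert_subset hp (singleton_subset_iff.2 hq)) hx

/-- A point of `cl T` with `T ⊆ cl S` lies in `cl S`. -/
theorem mem_clF_of_subset_clF' {x : α} {S T : Finset α} (hS : S ⊆ gr N) (hT : T ⊆ clF N S) (hx : x ∈ clF N T) :
    x ∈ clF N S :=
  clF_subset_clF_of_subset_clF hS hT hx

/-- **THE CONCLUSION OF BOTH CASES**: for `z ∈ τ` outside `cl(X − τ)` with `τ − z + e + f` of rank `4`, the set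
`τ − z + e + f` is bi-independent (its complement is `(X − τ) + z`, a basis). -/
theorem cpair_of_witness (hn : (gr N).card = 9) {e f : α} (he : e ∈ gr N) (hf : f ∈ gr N) (hef : e ≠ f)
    {τ : Finset α} (hτX : τ ⊆ ((gr N).erase e).erase f) (hτ3 : τ.card = 3)
    (hτe : insert e τ ∈ biIndepSets N 4) {z : α} (hz : z ∈ τ)
    (hzK : z ∉ clF N ((((gr N).erase e).erase f) \ τ))
    (hrk : rk N (insert e (insert f (τ.erase z))) = 4) :
    insert e (insert f (τ.erase z)) ∈ biIndepSets N 4 := by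
  have hXg : ((gr N).erase e).erase f ⊆ gr N := (erase_subset _ _).trans (erase_subset _ _)
  have hτg : τ ⊆ gr N := hτX.trans hXg
  have heτ : e ∉ τ := fun h => (mem_erase.1 (mem_erase.1 (hτX h)).2).1 rfl
  have hfτ : f ∉ τ := fun h => (mem_erase.1 (hτX h)).1 rfl
  have hzg : z ∈ gr N := hτg hz
  have hze : z ≠ e := fun h => heτ (h ▸ hz)
  have hzf : z ≠ f := fun h => hfτ (h ▸ hz)
  obtain ⟨_, _, _, hcompl⟩ := mem_biIndepSets.1 hτe
  -- the complement of `τ + e` is `K + f`, of rank `5`; `K` is independent of rank `4`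
  set K := (((gr N).erase e).erase f) \ τ with hK
  have hKg : K ⊆ gr N := sdiff_subset.trans hXg
  have hcard_X : (((gr N).erase e).erase f).card = 7 := by
    rw [card_erase_of_mem (mem_erase.2 ⟨hef.symm, hf⟩), card_erase_of_mem he, hn]
  have hKcard : K.card = 4 := by
    rw [hK, card_sdiff_of_subset hτX, hcard_X, hτ3]
  have hcompl_eq : gr N \ insert e τ = insert f K := by
    ext a
    simp only [hK, mem_sdiff, mem_insert, mem_erase, not_or]
    constructor
    · rintro ⟨hag, hae, haτ⟩
      by_cases haf : a = f
      · exact Or.inl haf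
      · exact Or.inr ⟨⟨haf, hae, hag⟩, haτ⟩
    · rintro (rfl | ⟨⟨haf, hae, hag⟩, haτ⟩)
      · exact ⟨hf, hef.symm, hfτ⟩
      · exact ⟨hag, hae, haτ⟩
  rw [hcompl_eq] at hcompl
  have hfK : f ∉ K := fun h => (mem_erase.1 (mem_sdiff.1 h).1).1 rfl
  have hcardfK : (insert f K).card = 5 := by rw [card_insert_of_notMem hfK, hKcard]
  have hKrk : rk N K = 4 := by
    have := rk_eq_card_of_subset_of_rk_eq_card (subset_insert f K) hcompl
    rw [hKcard] at this; exact this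
  rw [hcardfK] at hcompl
  -- the new complement `K + z` has rank `5`
  have hzK' : z ∉ K := fun h => (mem_sdiff.1 h).2 hz
  have hrkzK : rk N (insert z K) = 5 := by
    rw [rk_insert_of_notMem_clF' hzg hKg hzK, hKrk]
  have hcompl2 : gr N \ insert e (insert f (τ.erase z)) = insert z K := by
    ext a
    simp only [hK, mem_sdiff, mem_insert, mem_erase, not_or]
    constructor
    · rintro ⟨hag, hae, haf, haτ⟩
      by_cases haz : a = z
      · exact Or.inl haz
      · exact Or.inr ⟨⟨haf, hae, hag⟩, fun h => haτ ⟨haz, h⟩⟩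
    · rintro (rfl | ⟨⟨haf, hae, hag⟩, haτ⟩)
      · exact ⟨hzg, hze, hzf, fun h => h.1 rfl⟩
      · exact ⟨hag, hae, haf, fun h => haτ h.2⟩
  rw [mem_biIndepSets]
  have hfπ : f ∉ τ.erase z := fun h => hfτ (mem_of_mem_erase h)
  have heπ : e ∉ insert f (τ.erase z) := by
    rw [mem_insert]
    rintro (h | h)
    · exact hef h
    · exact heτ (mem_of_mem_erase h)
  refine ⟨?_, ?_, ?_, ?_⟩
  · exact insert_subset he (insert_subset hf ((erase_subset _ _).trans hτg))
  · rw [card_insert_of_notMem heπ, card_insert_of_notMem hfπ, card_erase_of_mem hz, hτ3]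
  · rw [hrk, card_insert_of_notMem heπ, card_insert_of_notMem hfπ, card_erase_of_mem hz, hτ3]
  · rw [hcompl2, hrkzK, card_insert_of_notMem hzK', hKcard]

/-- `{a, b, c} − a = {b, c}`. -/
theorem triple_erase_left {a b c : α} (hab : a ≠ b) (hac : a ≠ c) : ({a, b, c} : Finset α).erase a = {b, c} := by
  ext x
  simp only [mem_erase, mem_insert, mem_singleton]
  constructor
  · rintro ⟨hxa, rfl | rfl | rfl⟩
    · exact absurd rfl hxa
    · exact Or.inl rfl
    · exact Or.inr rfl
  · rintro (rfl | rfl)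
    · exact ⟨hab.symm, Or.inr (Or.inl rfl)⟩
    · exact ⟨hac.symm, Or.inr (Or.inr rfl)⟩

/-- `{a, b, c} − b = {a, c}`. -/
theorem triple_erase_mid {a b c : α} (hab : a ≠ b) (hbc : b ≠ c) : ({a, b, c} : Finset α).erase b = {a, c} := by
  ext x
  simp only [mem_erase, mem_insert, mem_singleton]
  constructor
  · rintro ⟨hxb, rfl | rfl | rfl⟩
    · exact Or.inl rfl
    · exact absurd rfl hxb
    · exact Or.inr rfl
  · rintro (rfl | rfl)
    · exact ⟨hab, Or.inl rfl⟩
    · exact ⟨hbc.symm, Or.inr (Or.inr rfl)⟩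

/-- `{a, b, c} − c = {a, b}`. -/
theorem triple_erase_right {a b c : α} (hac : a ≠ c) (hbc : b ≠ c) : ({a, b, c} : Finset α).erase c = {a, b} := by
  ext x
  simp only [mem_erase, mem_insert, mem_singleton]
  constructor
  · rintro ⟨hxc, rfl | rfl | rfl⟩
    · exact Or.inl rfl
    · exact Or.inr rfl
    · exact absurd rfl hxc
  · rintro (rfl | rfl)
    · exact ⟨hac, Or.inl rfl⟩
    · exact ⟨hbc, Or.inr (Or.inl rfl)⟩

/-- `{c, a, b} = {a, b, c}`. -/
theorem triple_rot_cab (a b c : α) : ({c, a, b} : Finset α) = {a, b, c} := by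
  ext x; simp only [mem_insert, mem_singleton]; tauto

/-- `{b, a, c} = {a, b, c}`. -/
theorem triple_swap_ba (a b c : α) : ({b, a, c} : Finset α) = {a, b, c} := by
  ext x; simp only [mem_insert, mem_singleton]; tauto

/-- **TYPE 1, TWO CANDIDATES**: `τ = {w, z₁, z₂}` independent, `f ∈ cl τ`, `z₁, z₂ ∉ cl K`, `f ∉ cl K`; then
`f ∉ cl {w, z₂}` or `f ∉ cl {w, z₁}` (else `z₁, z₂ ∈ cl {w, f}` and `τ` would have rank `≤ 2`). -/
theorem type_one_two_candidates (hsimple : ∀ x ∈ gr N, ∀ y ∈ gr N, x ≠ y → rk N {x, y} = 2) {f w z₁ z₂ : α}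
    (hf : f ∈ gr N) (hw : w ∈ gr N) (hz₁ : z₁ ∈ gr N) (hz₂ : z₂ ∈ gr N) (hwz₁ : w ≠ z₁) (hwz₂ : w ≠ z₂)
    (hz₁z₂ : z₁ ≠ z₂) (hfw : f ≠ w) (hfz₁ : f ≠ z₁) (hfz₂ : f ≠ z₂) (hτ : rk N ({w, z₁, z₂} : Finset α) = 3) :
    f ∉ clF N ({w, z₂} : Finset α) ∨ f ∉ clF N ({w, z₁} : Finset α) := by
  by_contra hcon
  rw [not_or, not_not, not_not] at hcon
  obtain ⟨h2, h1⟩ := hcon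
  have hwf : rk N ({w, f} : Finset α) = 2 := hsimple w hw f hf hfw.symm
  have hwfg : ({w, f} : Finset α) ⊆ gr N := insert_subset hw (singleton_subset_iff.2 hf)
  have key : ∀ z ∈ gr N, f ∈ clF N ({w, z} : Finset α) → w ≠ z → z ∈ clF N ({w, f} : Finset α) := by
    intro z hz hfz hwz
    have e1 : insert z ({w, f} : Finset α) = insert f ({w, z} : Finset α) := by
      ext x; simp only [mem_insert, mem_singleton]; tauto
    rw [mem_clF_iff_rk_insert hz hwfg, e1, rk_insert_of_mem_clF' hf (insert_subset hw (singleton_subset_iff.2 hz)) hfz,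
      hsimple w hw z hz hwz, hwf]
  have hz₁' := key z₁ hz₁ h1 hwz₁
  have hz₂' := key z₂ hz₂ h2 hwz₂
  have hsub : ({w, z₁, z₂} : Finset α) ⊆ clF N ({w, f} : Finset α) := by
    intro x hx
    simp only [mem_insert, mem_singleton] at hx
    rcases hx with rfl | rfl | rfl
    · exact subset_clF hwfg (mem_insert_self _ _)
    · exact hz₁'
    · exact hz₂'
  have := rk_le_rk_of_subset_clF (N := N) hsub
  rw [hτ, hwf] at this
  omega

/-- **THE RANK OF `π + e + f` IN TYPE 1**: with `π = τ − z`, `π + f` independent of rank `3` and `ρ(τ + f) = 3`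
(so `z ∈ cl(π + f)`), `ρ(π + e + f) = 4` — else `e ∈ cl(π + f)` too and `τ + e ⊆ cl(π + f)` would have rank `≤ 3`. -/
theorem rk_insert_insert_of_type_one {e f z : α} (he : e ∈ gr N) (hf : f ∈ gr N) (hz : z ∈ gr N)
    {π : Finset α} (hπg : π ⊆ gr N) (hzπ : z ∉ π) (hπf : rk N (insert f π) = 3)
    (hτf : rk N (insert f (insert z π)) = 3) (hτe : rk N (insert e (insert z π)) = 4) :
    rk N (insert e (insert f π)) = 4 := by
  have hQg : insert f π ⊆ gr N := insert_subset hf hπg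
  by_contra hne
  have hle : rk N (insert e (insert f π)) ≤ 3 := by
    have h6 := rk_insert_eq he hQg (M := N)
    split_ifs at h6 <;> omega
  have heQ : e ∈ clF N (insert f π) := by
    rw [mem_clF_iff_rk_insert he hQg]
    have := rk_mono' (M := N) (subset_insert e (insert f π))
    omega
  have hzQ : z ∈ clF N (insert f π) := by
    rw [mem_clF_iff_rk_insert hz hQg]
    have e1 : insert z (insert f π) = insert f (insert z π) := insert_comm z f π
    rw [e1, hτf, hπf]
  have hsub : insert e (insert z π) ⊆ clF N (insert f π) := by
    intro x hx
    rw [mem_insert, mem_insert] at hx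
    rcases hx with rfl | rfl | hx
    · exact heQ
    · exact hzQ
    · exact subset_clF hQg (mem_insert_of_mem hx)
  have := rk_le_rk_of_subset_clF (N := N) hsub
  rw [hτe, hπf] at this
  omega

/-- `#{a, b, c} = 3` for distinct points. -/
theorem card_triple' {a b c : α} (hab : a ≠ b) (hac : a ≠ c) (hbc : b ≠ c) : ({a, b, c} : Finset α).card = 3 := by
  rw [card_insert_of_notMem (by simp only [mem_insert, mem_singleton, not_or]; exact ⟨hab, hac⟩), card_pair hbc]

/-- `#(insert e {a, b, c}) = 4` for distinct points. -/
theorem card_insert_triple' {e a b c : α} (hea : e ≠ a) (heb : e ≠ b) (hec : e ≠ c) (hab : a ≠ b) (hac : a ≠ c)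
    (hbc : b ≠ c) : (insert e ({a, b, c} : Finset α)).card = 4 := by
  rw [card_insert_of_notMem (by simp only [mem_insert, mem_singleton, not_or]; exact ⟨hea, heb, hec⟩),
    card_triple' hab hac hbc]

/-- **TYPE 2, TWO CANDIDATES**: `τ = {w, z₁, z₂}` with `τ + e` independent, `f ∉ cl K`, `e ∈ cl K`, `z₁, z₂ ∉ cl K`, and
`w` not a working candidate (`w ∈ cl K`, or `f ∈ cl(e + z₁ + z₂)`); then `f ∉ cl(e + w + z₂)` or `f ∉ cl(e + w + z₁)`. -/
theorem type_two_two_candidates (hsimple : ∀ x ∈ gr N, ∀ y ∈ gr N, x ≠ y → rk N {x, y} = 2) {e f w z₁ z₂ : α}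
    {K : Finset α} (hKg : K ⊆ gr N) (he : e ∈ gr N) (hf : f ∈ gr N) (hw : w ∈ gr N) (hz₁ : z₁ ∈ gr N)
    (hz₂ : z₂ ∈ gr N) (hew : e ≠ w) (hez₁ : e ≠ z₁) (hez₂ : e ≠ z₂) (hwz₁ : w ≠ z₁) (hwz₂ : w ≠ z₂)
    (hz₁z₂ : z₁ ≠ z₂) (hef : e ≠ f) (hfK : f ∉ clF N K) (heK : e ∈ clF N K)
    (hwbad : w ∈ clF N K ∨ f ∈ clF N (insert e ({z₁, z₂} : Finset α)))
    (hτe : rk N (insert e ({w, z₁, z₂} : Finset α)) = 4) :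
    f ∉ clF N (insert e ({w, z₂} : Finset α)) ∨ f ∉ clF N (insert e ({w, z₁} : Finset α)) := by
  by_contra hcon
  rw [not_or, not_not, not_not] at hcon
  obtain ⟨h2, h1⟩ := hcon
  have hPg : ({e, w} : Finset α) ⊆ gr N := insert_subset he (singleton_subset_iff.2 hw)
  have hP : rk N ({e, w} : Finset α) = 2 := hsimple e he w hw hew
  have hτeg : insert e ({w, z₁, z₂} : Finset α) ⊆ gr N :=
    insert_subset he (insert_subset hw (insert_subset hz₁ (singleton_subset_iff.2 hz₂)))
  have hτe' : rk N (insert e ({w, z₁, z₂} : Finset α)) = (insert e ({w, z₁, z₂} : Finset α)).card := by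
    rw [hτe, card_insert_triple' hew hez₁ hez₂ hwz₁ hwz₂ hz₁z₂]
  have hsub2 : insert e ({w, z₂} : Finset α) ⊆ insert e ({w, z₁, z₂} : Finset α) := by
    intro x hx; simp only [mem_insert, mem_singleton] at hx ⊢; tauto
  have hsub1 : insert e ({w, z₁} : Finset α) ⊆ insert e ({w, z₁, z₂} : Finset α) := by
    intro x hx; simp only [mem_insert, mem_singleton] at hx ⊢; tauto
  have hr2 : rk N (insert e ({w, z₂} : Finset α)) = 3 := by
    rw [rk_eq_card_of_subset_of_rk_eq_card hsub2 hτe', card_insert_of_notMem (by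
      simp only [mem_insert, mem_singleton, not_or]; exact ⟨hew, hez₂⟩), card_pair hwz₂]
  have hr1 : rk N (insert e ({w, z₁} : Finset α)) = 3 := by
    rw [rk_eq_card_of_subset_of_rk_eq_card hsub1 hτe', card_insert_of_notMem (by
      simp only [mem_insert, mem_singleton, not_or]; exact ⟨hew, hez₁⟩), card_pair hwz₁]
  -- step 1: `f ∈ cl {e, w}`
  have hfP : f ∈ clF N ({e, w} : Finset α) := by
    by_contra hfP
    have hQ : rk N (insert f ({e, w} : Finset α)) = 3 := by
      rw [rk_insert_of_notMem_clF' hf hPg hfP, hP]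
    have hQg : insert f ({e, w} : Finset α) ⊆ gr N := insert_subset hf hPg
    have key : ∀ z ∈ gr N, f ∈ clF N (insert e ({w, z} : Finset α)) →
        rk N (insert e ({w, z} : Finset α)) = 3 → z ∈ clF N (insert f ({e, w} : Finset α)) := by
      intro z hz hfz hr
      rw [mem_clF_iff_rk_insert hz hQg]
      have e1 : insert z (insert f ({e, w} : Finset α)) = insert f (insert e ({w, z} : Finset α)) := by
        ext x; simp only [mem_insert, mem_singleton]; tauto
      rw [e1, rk_insert_of_mem_clF' hf (insert_subset he (insert_subset hw (singleton_subset_iff.2 hz))) hfz, hr,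
        hQ]
    have hz₁Q := key z₁ hz₁ h1 hr1
    have hz₂Q := key z₂ hz₂ h2 hr2
    have hsub : insert e ({w, z₁, z₂} : Finset α) ⊆ clF N (insert f ({e, w} : Finset α)) := by
      intro x hx
      simp only [mem_insert, mem_singleton] at hx
      rcases hx with rfl | rfl | rfl | rfl
      · exact subset_clF hQg (mem_insert_of_mem (mem_insert_self _ _))
      · exact subset_clF hQg (mem_insert_of_mem (mem_insert_of_mem (mem_singleton_self _)))
      · exact hz₁Q
      · exact hz₂Q
    have := rk_le_rk_of_subset_clF (N := N) hsub
    rw [hτe, hQ] at this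
    omega
  -- step 2: the two ways `w` fails
  rcases hwbad with hwK | hfz
  · exact hfK (mem_clF_of_mem_clF_pair' hKg heK hwK hfP)
  · -- `w ∈ cl {e, f} ⊆ cl(e + z₁ + z₂)`, so `τ + e` has rank `≤ 3`
    have hefg : ({e, f} : Finset α) ⊆ gr N := insert_subset he (singleton_subset_iff.2 hf)
    have hwef : w ∈ clF N ({e, f} : Finset α) := by
      rw [mem_clF_iff_rk_insert hw hefg]
      have e1 : insert w ({e, f} : Finset α) = insert f ({e, w} : Finset α) := by
        ext x; simp only [mem_insert, mem_singleton]; tauto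
      rw [e1, rk_insert_of_mem_clF' hf hPg hfP, hP, hsimple e he f hf hef]
    have hRg : insert e ({z₁, z₂} : Finset α) ⊆ gr N := insert_subset he (insert_subset hz₁ (singleton_subset_iff.2 hz₂))
    have hwR : w ∈ clF N (insert e ({z₁, z₂} : Finset α)) :=
      mem_clF_of_mem_clF_pair' hRg (subset_clF hRg (mem_insert_self _ _)) hfz hwef
    have hsub : insert e ({w, z₁, z₂} : Finset α) ⊆ clF N (insert e ({z₁, z₂} : Finset α)) := by
      intro x hx
      simp only [mem_insert, mem_singleton] at hx
      rcases hx with rfl | rfl | rfl | rfl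
      · exact subset_clF hRg (mem_insert_self _ _)
      · exact hwR
      · exact subset_clF hRg (mem_insert_of_mem (mem_insert_self _ _))
      · exact subset_clF hRg (mem_insert_of_mem (mem_insert_of_mem (mem_singleton_self _)))
    have h3 := rk_le_rk_of_subset_clF (N := N) hsub
    have h4 := rk_le_card (M := N) (insert e ({z₁, z₂} : Finset α))
    rw [hτe] at h3
    rw [card_insert_of_notMem (by simp only [mem_insert, mem_singleton, not_or]; exact ⟨hez₁, hez₂⟩),
      card_pair hz₁z₂] at h4
    omega

/-- **THE RANK OF `π + e + f` IN TYPE 2**: `ρ(π + e) = 3` and `f ∉ cl(π + e)` give `ρ(π + e + f) = 4`. -/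
theorem rk_insert_insert_of_type_two {e f : α} (he : e ∈ gr N) (hf : f ∈ gr N) {π : Finset α} (hπg : π ⊆ gr N)
    (hπe : rk N (insert e π) = 3) (hfπ : f ∉ clF N (insert e π)) : rk N (insert e (insert f π)) = 4 := by
  rw [insert_comm, rk_insert_of_notMem_clF' hf (insert_subset he hπg) hfπ, hπe]

end StarNineDefectA

end PercRepro.Cogirth
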